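import Literature.Geometry.Kaehler.RiemannSurfaceJacobianPolarizationGram
import Literature.Geometry.Kaehler.ComplexTorusRiemannRelations
import HarnessLib

/-!
# The Riemann relations for the period matrix of a compact Riemann surface
# (Lange, *Abelian Varieties over the Complex Numbers*, §2.1.5 Theorem 2.1.18 with §4.1.2 Prop. 4.1.2;
# Griffiths–Harris pp. 231–232 «Riemann's bilinear relations»)

Layer `Literature/Geometry/Kaehler`, a bridge between `RiemannSurfaceJacobianPolarization`
(**`isRiemannForm_jacobianRiemannForm`**: the canonical Riemann form `E` of `ℂ^g/Π ℤ^{2g} ≅ Jac(M)`) and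
the lane's `ComplexTorusRiemannRelations` (Lange Thm. 2.1.18 "⟹": a Riemann form yields a
non-degenerate alternating `A ∈ M_{2g}(ℤ)` — the matrix of `E` on the lattice basis — with
(i) `Π A⁻¹ ᵗΠ = 0` and (ii) `i Π A⁻¹ ᵗΠ̄ > 0`).

* `riemannPeriodMatrix x₀ w c : Matrix σ κ ℂ`, `Π_{j i} = ∫_{c_i} w_j` — the period matrix of the basis
  `w` of `Ω(M)` against the `ℤ`-basis `c` of the period lattice (`periodMatrix_eq_mulVec`: it is the matrix
  of the tree's period isomorphism `periodMatrix x₀ w c : ℝ^{2g} ≃ ℂ^g`);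
* **`riemann_bilinear_relations`**: there is an antisymmetric `A ∈ M_{2g}(ℤ)` with `det A ≠ 0` — the Gram
  matrix of the canonical polarization on the basis `c` (`latticeGram`, equal to `periodGram` of
  `RiemannSurfaceJacobianPolarizationGram`) — such that `Π A⁻¹ ᵗΠ = 0` and `i Π A⁻¹ ᵗΠ̄` is positive
  definite (THE RIEMANN BILINEAR RELATIONS for the periods of the holomorphic differentials of `M`).

Everything is proved; no named facts, no instances.

## References

* H. Lange, *Abelian Varieties over the Complex Numbers*, Springer (2023), §2.1.5 Theorem 2.1.18 (Riemann
  Relations), §4.1.2 Proposition 4.1.2. [Lange2023AbelianVarietiesComplex]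
* P. Griffiths, J. Harris, *Principles of Algebraic Geometry* (1978), Ch. 2 §2, pp. 231–232 (Riemann's
  bilinear relations). [GriffithsHarris1978]
* O. Forster, *Lectures on Riemann Surfaces*, GTM 81 (1981), §21.7. [Forster1981]
-/

noncomputable section

open scoped Manifold ContDiff Topology ComplexConjugate ComplexOrder
open Set Function Complex Module Matrix
open Literature.Topology.CoveringSpaces

namespace Literature.Geometry.Kaehler

namespace RiemannSurface

open MeromorphicOneForm ComplexTorus

universe u

variable {M : Type u} [TopologicalSpace M] [ChartedSpace ℂ M] [ConnectedSpace M] [IsManifold 𝓘(ℂ, ℂ) ω M]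
  [IsManifold 𝓘(ℝ, ℂ) ∞ M] [CompactSpace M] [T2Space M] [Fact (Module.finrank ℝ ℂ = 2)]
  {σ : Type*} [Fintype σ] [DecidableEq σ] (w : Module.Basis σ ℂ ↥(holomorphicOneForms M)) (x₀ : M)
  {κ : Type*} [Fintype κ] [DecidableEq κ] (c : Module.Basis κ ℤ ↥(periods x₀))

omit [IsManifold 𝓘(ℝ, ℂ) ∞ M] [CompactSpace M] [T2Space M] [Fact (Module.finrank ℝ ℂ = 2)] [Fintype σ]
  [DecidableEq σ] [Fintype κ] [DecidableEq κ] in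
/-- **The period matrix** `Π ∈ M_{g × 2g}(ℂ)` of a compact Riemann surface: `Π_{j i} = ∫_{c_i} w_j`, the
periods of the basis `w` of `Ω(M)` along the `ℤ`-basis `c` of the period lattice `Λ ≅ H₁(M, ℤ)`.
[cite: Lange2023AbelianVarietiesComplex, §4.1.2 and §2.1.5] [cite: Miranda1995, Chapter VIII §4 Definition 4.9] -/
def riemannPeriodMatrix : Matrix σ κ ℂ := fun j i ↦
  ((c i : ↥(periods x₀)) : Module.Dual ℂ ↥(holomorphicOneForms M)) (w j)

omit [IsManifold 𝓘(ℝ, ℂ) ∞ M] [CompactSpace M] [T2Space M] [Fact (Module.finrank ℝ ℂ = 2)] [Fintype σ]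
  [DecidableEq σ] [Fintype κ] [DecidableEq κ] in
/-- Entries of the period matrix. [cite: Miranda1995, Chapter VIII §4 Definition 4.9] -/
theorem riemannPeriodMatrix_apply (j : σ) (i : κ) :
    riemannPeriodMatrix w x₀ c j i = ((c i : ↥(periods x₀)) : Module.Dual ℂ ↥(holomorphicOneForms M)) (w j) := rfl

omit [IsManifold 𝓘(ℝ, ℂ) ∞ M] [Fact (Module.finrank ℝ ℂ = 2)] [DecidableEq κ] in
/-- **The period isomorphism is multiplication by the period matrix**: `periodMatrix x₀ w c t = Π t`.
[cite: Lange2023AbelianVarietiesComplex, §1.1.1 (period matrices)] [cite: Miranda1995, Chapter VIII §4 Definition 4.9] -/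
theorem periodMatrix_eq_mulVec (t : κ → ℝ) :
    periodMatrix x₀ w c t = riemannPeriodMatrix w x₀ c *ᵥ fun i ↦ (t i : ℂ) := by
  funext j
  rw [periodMatrix_apply, Finset.sum_apply, Matrix.mulVec, dotProduct]
  refine Finset.sum_congr rfl fun i _ ↦ ?_
  rw [Pi.smul_apply, dualCoords_apply, riemannPeriodMatrix_apply, Complex.real_smul, mul_comm]

/-- The lattice Gram matrix of the canonical Riemann form is the Gram matrix `periodGram` of
`RiemannSurfaceJacobianPolarizationGram`. [cite: Lange2023AbelianVarietiesComplex, §1.5.1 and §4.1] -/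
theorem latticeGram_periodMatrix_jacobianRiemannForm :
    latticeGram (periodMatrix x₀ w c) (jacobianRiemannForm w) = periodGram w x₀ c := by
  ext i j
  rw [latticeGram_apply, periodGram_apply]
  have h : ∀ i : κ, periodMatrix x₀ w c (Pi.single i 1) = periodBasis x₀ w c i := fun i ↦ by
    change (periodBasis x₀ w c).equivFun.symm (Pi.single i 1) = _
    rw [Module.Basis.equivFun_symm_apply, Finset.sum_eq_single i (fun k _ hk ↦ by simp [hk])
      (fun hi ↦ (hi (Finset.mem_univ i)).elim)]
    simp
  rw [h i, h j]

/-- **RIEMANN'S BILINEAR RELATIONS for the period matrix of a compact connected Riemann surface.**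
With `Π_{j i} = ∫_{c_i} w_j` the period matrix of a basis `w` of `Ω(M)` against a `ℤ`-basis `c` of the
period lattice, there is an antisymmetric integer matrix `A ∈ M_{2g}(ℤ)` with `det A ≠ 0` — the matrix
of the canonical polarization `E` on the basis `c` — such that
(i) `Π A⁻¹ ᵗΠ = 0` and (ii) `i Π A⁻¹ ᵗΠ̄` is positive definite (Lange Thm. 2.1.18 "⟹" applied to the
Riemann form of `Jac(M)`, Prop. 4.1.2). [cite: Lange2023AbelianVarietiesComplex, §2.1.5 Theorem 2.1.18 and §4.1.2 Proposition 4.1.2] [cite: GriffithsHarris1978, Ch. 2 §2, pp. 231–232] -/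
theorem riemann_bilinear_relations :
    ∃ A : Matrix κ κ ℤ,
      A.map (Int.cast : ℤ → ℝ) = latticeGram (periodMatrix x₀ w c) (jacobianRiemannForm w) ∧
      Aᵀ = -A ∧ A.det ≠ 0 ∧
      riemannPeriodMatrix w x₀ c * (A.map (Int.cast : ℤ → ℂ))⁻¹ * (riemannPeriodMatrix w x₀ c)ᵀ = 0 ∧
      (Complex.I • (riemannPeriodMatrix w x₀ c * (A.map (Int.cast : ℤ → ℂ))⁻¹ *
        (riemannPeriodMatrix w x₀ c)ᴴ)).PosDef :=
  (isRiemannForm_jacobianRiemannForm w x₀ c).exists_riemannRelations (periodMatrix_eq_mulVec w x₀ c)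

/-- The same with the Gram matrix named: `A = periodGram` (`= (E(Π e_i, Π e_j))`, the integers
`2 Re ∫_{γ_j} η_{γ_i}` of `RiemannSurfaceLoopDifferentials`). [cite: Lange2023AbelianVarietiesComplex, §2.1.5 Theorem 2.1.18 and §4.1.2 Proposition 4.1.2] -/
theorem riemann_bilinear_relations_periodGram :
    ∃ A : Matrix κ κ ℤ, A.map (Int.cast : ℤ → ℝ) = periodGram w x₀ c ∧ Aᵀ = -A ∧ A.det ≠ 0 ∧
      riemannPeriodMatrix w x₀ c * (A.map (Int.cast : ℤ → ℂ))⁻¹ * (riemannPeriodMatrix w x₀ c)ᵀ = 0 ∧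
      (Complex.I • (riemannPeriodMatrix w x₀ c * (A.map (Int.cast : ℤ → ℂ))⁻¹ *
        (riemannPeriodMatrix w x₀ c)ᴴ)).PosDef := by
  obtain ⟨A, hA, h⟩ := riemann_bilinear_relations w x₀ c
  exact ⟨A, by rw [hA, latticeGram_periodMatrix_jacobianRiemannForm], h⟩

end RiemannSurface

end Literature.Geometry.Kaehler

end
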